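import Literature.MathematicalPhysics.QuantumLattice.BdGBondHamiltonianParticleHole
import Literature.MathematicalPhysics.QuantumLattice.BdGBondHamiltonianTorus
import Literature.MathematicalPhysics.QuantumLattice.ApproximatingHamiltonianProofs
import HarnessLib

/-!
# Lieb's partial particle–hole transformation of the INTERACTING (`d`-wave–sourced) Hubbard model

Topic `MathematicalPhysics/QuantumLattice`. The tree has Lieb's partial particle–hole
transformation `W = partialParticleHole D↓` (`c_{x↓} ↦ c†_{x↓}`, spin-up untouched;
`PartialParticleHole(Quadratic).lean`) and its action on QUADRATIC Hamiltonians
(`partialParticleHole_conj_bdgBondHamiltonian`: `W H_BdG(τ,Δ,μ) Wᴴ = dΓ(𝓗) + C·1`, the BdG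
Hamiltonian becomes a number-conserving free Fermi gas). This file adds the interaction:

* `partialParticleHole_conj_numberOp_up/down` — `W n_{x↑} Wᴴ = n_{x↑}`, `W n_{x↓} Wᴴ = 1 - n_{x↓}`;
  `partialParticleHole_conj_onSiteRepulsion` — **`W (Σ_x n_{x↑}n_{x↓}) Wᴴ = N_↑ - Σ_x n_{x↑}n_{x↓}`**:
  the on-site repulsion `U` becomes the on-site ATTRACTION `-U` plus the one-body term `U N_↑`
  (Lieb 1989, proof of Thm 2; Shiba 1972; the "attraction–repulsion" correspondence of
  Micnas–Ranninger–Robaszkiewicz 1990 §II.B).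
* `hamiltonianWith_eq_bdgBondHamiltonian_add` — `H(t,U) - μN = H_BdG(-t[x∼y], 0, μ) + U Σ_x n_{x↑}n_{x↓}`
  and `partialParticleHole_conj_bdgBondHamiltonian_add_onSite` /
  `partialParticleHole_conj_hamiltonianWith` — the conjugate of "BdG + on-site interaction", in
  particular of the grand-canonical Hubbard Hamiltonian on any finite graph:
  `W (H(t,U) - μN) Wᴴ = dΓ(𝓗(-t[x∼y], 0, μ)) - μ|Λ|·1 + U (N_↑ - Σ_x n_{x↑}n_{x↓})`.
* The `d`-wave–sourced torus of `DWaveSource.lean`: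
  `pairField_dWaveFormFactor_eq_bdgPairing` (the pair field `Δ_d` is `bdgPairing` of the bond
  amplitude `√2·(±1)` on the directed bonds `(x, x+eᵢ)`, every `L ≥ 1`),
  `dWaveSourceTorus_eq_bdgBondHamiltonian_add`
  (`H(1,U) - μN - h(Δ_d + Δ_d†) = H_BdG(-[x∼y], -h√2(±1)·bond, μ) + U Σ_x n_{x↑}n_{x↓}`), and
  **`partialParticleHole_conj_dWaveSourceTorus`**:
  `W · dWaveSourceTorus L U μ h · Wᴴ = dΓ(𝓗_{L,μ,h}) - μL²·1 + U (N_↑ - Σ_x n_{x↑}n_{x↓})` —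
  after the transformation the sourced, `U(1)`-breaking, repulsive model is a NUMBER-CONSERVING
  two-band lattice fermion system (the pair source has become the spin-flip hopping block of the
  Nambu matrix `𝓗 = bdgNambuMatrix`) with an attractive density–density interaction; hence
  `partitionFn_dWaveSourceTorus_eq` —
  `Tr e^{-β dWaveSourceTorus L U μ h} = e^{βμL²} Tr e^{-β(dΓ(𝓗_{L,μ,h}) + U(N_↑ - Σ_x n_{x↑}n_{x↓}))}`.
  This is the form in which determinant (rather than Pfaffian) perturbation theory in `U`
  (`HubbardDysonDeterminant`, `HubbardLinkedCluster`) applies to the sourced pressure.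

Everything is PROVED; no definition and no named fact is introduced (the bond amplitudes are
written as explicit functions in the statements).

## References

* E. H. Lieb, *Two theorems on the Hubbard model*, PRL 62 (1989) 1201, proof of Theorem 2
  (the partial particle–hole transformation and `U ↦ -U`). [Lieb1989]
* H. Shiba, Prog. Theor. Phys. 48 (1972) 2171, §2 (the canonical transformation between the
  repulsive and the attractive Hubbard model in a field). [Shiba1972]
* R. Micnas, J. Ranninger, S. Robaszkiewicz, Rev. Mod. Phys. 62 (1990) 113, §II.B
  (attraction–repulsion transformation; pairing ↔ transverse magnetism). [MicnasRanningerRobaszkiewicz1990]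
* V. Bach, E. H. Lieb, J. P. Solovej, J. Stat. Phys. 76 (1994) 3, §2. [BachLiebSolovej1994]
-/

noncomputable section

namespace Literature.MathematicalPhysics.QuantumLattice

open Matrix Finset HubbardWave0 Literature.Probability.LatticeModels
open scoped ComplexOrder ComplexConjugate

/-! ### The on-site interaction under the partial particle–hole transformation -/

section General

variable {Λ : Type*} [LinearOrder Λ] [Fintype Λ]

/-- Spin-up number operators are untouched: `W n_{x↑} Wᴴ = n_{x↑}` (`W = partialParticleHole D↓`).
[cite: Lieb1989, proof of Theorem 2] -/
theorem partialParticleHole_conj_numberOp_up (x : Λ) :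
    partialParticleHole (spinDownOrbitals : Finset (Orb Λ)) * numberOp x 0 *
        (partialParticleHole (spinDownOrbitals : Finset (Orb Λ)))ᴴ = numberOp x 0 := by
  have hx : orb x 0 ∉ (spinDownOrbitals : Finset (Orb Λ)) := by
    rw [orb_mem_spinDownOrbitals_iff]; exact Fin.zero_ne_one
  rw [numberOp, partialParticleHole_conj_mul, partialParticleHole_conj_creation_of_not_mem hx,
    partialParticleHole_conj_annihilation_of_not_mem hx]

/-- Spin-down number operators are particle–hole exchanged: `W n_{x↓} Wᴴ = c_{x↓}c†_{x↓} = 1 - n_{x↓}`.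
[cite: Lieb1989, proof of Theorem 2] -/
theorem partialParticleHole_conj_numberOp_down (x : Λ) :
    partialParticleHole (spinDownOrbitals : Finset (Orb Λ)) * numberOp x 1 *
        (partialParticleHole (spinDownOrbitals : Finset (Orb Λ)))ᴴ = 1 - numberOp x 1 := by
  have hx : orb x 1 ∈ (spinDownOrbitals : Finset (Orb Λ)) := by
    rw [orb_mem_spinDownOrbitals_iff]
  rw [numberOp, partialParticleHole_conj_mul, partialParticleHole_conj_creation_of_mem hx,
    partialParticleHole_conj_annihilation_of_mem hx, annihilation_mul_creation, if_pos rfl]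

/-- **The on-site repulsion becomes an attraction plus a one-body term**:
`W (Σ_x n_{x↑} n_{x↓}) Wᴴ = Σ_x n_{x↑}(1 - n_{x↓}) = N_↑ - Σ_x n_{x↑} n_{x↓}`. Lieb 1989 (proof of
Thm 2: "the transformation … changes `U` into `-U`"); Shiba 1972 §2.
[cite: Lieb1989, proof of Theorem 2] -/
theorem partialParticleHole_conj_onSiteRepulsion :
    partialParticleHole (spinDownOrbitals : Finset (Orb Λ)) * (∑ x : Λ, numberOp x 0 * numberOp x 1) *
        (partialParticleHole (spinDownOrbitals : Finset (Orb Λ)))ᴴ =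
      (∑ x : Λ, numberOp x 0) - ∑ x : Λ, numberOp x 0 * numberOp x 1 := by
  rw [partialParticleHole_conj_sum, ← Finset.sum_sub_distrib]
  refine Finset.sum_congr rfl fun x _ => ?_
  rw [partialParticleHole_conj_mul, partialParticleHole_conj_numberOp_up,
    partialParticleHole_conj_numberOp_down, Matrix.mul_sub, Matrix.mul_one]

/-- The grand-canonical Hubbard Hamiltonian split into its BdG (free) part and the interaction:
`H(t,U) - μN = H_BdG(-t[x∼y], 0, μ) + U Σ_x n_{x↑}n_{x↓}` (`bdgBondHamiltonian_adj_zero`). [folklore] -/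
theorem hamiltonianWith_eq_bdgBondHamiltonian_add (G : SimpleGraph Λ) [DecidableRel G.Adj]
    (t U μ : ℝ) :
    hamiltonianWith G t U μ =
      bdgBondHamiltonian (fun x y => if G.Adj x y then -(t : ℂ) else 0) 0 μ +
        (U : ℂ) • ∑ x : Λ, numberOp x 0 * numberOp x 1 := by
  rw [bdgBondHamiltonian_adj_zero, hamiltonianWith, hamiltonianWith, hamiltonian, hamiltonian,
    Complex.ofReal_zero, zero_smul, add_zero]
  abel

/-- **Partial particle–hole transform of "BdG + on-site interaction"**: for arbitrary bond data
`(τ, Δ)`, chemical potential `μ` and coupling `U`,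
`W (H_BdG(τ,Δ,μ) + U Σ_x n_{x↑}n_{x↓}) Wᴴ = dΓ(𝓗(τ,Δ,μ)) + (Σ_x (τ(x,x) - μ))·1 + U (N_↑ - Σ_x n_{x↑}n_{x↓})`,
`𝓗 = bdgNambuMatrix τ Δ μ`: a number-conserving one-body part plus an attractive on-site interaction.
[cite: Lieb1989, proof of Theorem 2] -/
theorem partialParticleHole_conj_bdgBondHamiltonian_add_onSite (τ Δ : Λ → Λ → ℂ) (μ : ℝ) (U : ℂ) :
    partialParticleHole (spinDownOrbitals : Finset (Orb Λ)) *
        (bdgBondHamiltonian τ Δ μ + U • ∑ x : Λ, numberOp x 0 * numberOp x 1) *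
        (partialParticleHole (spinDownOrbitals : Finset (Orb Λ)))ᴴ =
      dGamma (bdgNambuMatrix τ Δ μ) +
        (∑ x : Λ, (τ x x - μ)) • (1 : Matrix (Finset (Orb Λ)) (Finset (Orb Λ)) ℂ) +
        U • ((∑ x : Λ, numberOp x 0) - ∑ x : Λ, numberOp x 0 * numberOp x 1) := by
  rw [Matrix.mul_add, Matrix.add_mul, partialParticleHole_conj_bdgBondHamiltonian, Matrix.mul_smul,
    Matrix.smul_mul, partialParticleHole_conj_onSiteRepulsion]

/-- **Lieb's transformation of the interacting grand-canonical Hubbard Hamiltonian** on a finite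
graph: `W (H(t,U) - μN) Wᴴ = dΓ(𝓗(-t[x∼y], 0, μ)) - μ|Λ|·1 + U (N_↑ - Σ_x n_{x↑}n_{x↓})` — the
repulsive model at chemical potential `μ` is unitarily the attractive model (`-U`) with the
spin-dependent one-body matrix `𝓗` (`↑↑` block `-t[x∼y] - μ`, `↓↓` block `+t[x∼y] + μ`: for the
down spins hopping and chemical potential change sign, the latter acting as a Zeeman field) and
the extra one-body term `U N_↑`. Lieb 1989, proof of Thm 2; Shiba 1972 §2.
[cite: Lieb1989, proof of Theorem 2] -/
theorem partialParticleHole_conj_hamiltonianWith (G : SimpleGraph Λ) [DecidableRel G.Adj]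
    (t U μ : ℝ) :
    partialParticleHole (spinDownOrbitals : Finset (Orb Λ)) * hamiltonianWith G t U μ *
        (partialParticleHole (spinDownOrbitals : Finset (Orb Λ)))ᴴ =
      dGamma (bdgNambuMatrix (fun x y => if G.Adj x y then -(t : ℂ) else 0) 0 μ) -
        ((μ : ℂ) * Fintype.card Λ) • (1 : Matrix (Finset (Orb Λ)) (Finset (Orb Λ)) ℂ) +
        (U : ℂ) • ((∑ x : Λ, numberOp x 0) - ∑ x : Λ, numberOp x 0 * numberOp x 1) := by
  have hdiag : (∑ x : Λ, ((if G.Adj x x then -(t : ℂ) else 0) - μ)) = -((μ : ℂ) * Fintype.card Λ) := by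
    simp only [SimpleGraph.irrefl, if_false, zero_sub, Finset.sum_neg_distrib, Finset.sum_const,
      Finset.card_univ, nsmul_eq_mul]
    ring
  rw [hamiltonianWith_eq_bdgBondHamiltonian_add, partialParticleHole_conj_bdgBondHamiltonian_add_onSite,
    hdiag, neg_smul, ← sub_eq_add_neg]

/-- **Partition function of "BdG + on-site interaction" in number-conserving form**: for all bond
data `(τ, Δ)`, real `μ, β` and complex `U`,
`Tr e^{-β(H_BdG(τ,Δ,μ) + U Σ_x n_{x↑}n_{x↓})} = e^{-β Σ_x (τ(x,x) - μ)} · Tr e^{-β(dΓ(𝓗(τ,Δ,μ)) + U(N_↑ - Σ_x n_{x↑}n_{x↓}))}`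
(unitary invariance of the trace under `W` and `e^{-β(X + c·1)} = e^{-βc} e^{-βX}`); at `U = 0` this
is `partitionFn_bdgBondHamiltonian` (the determinant `det(1 + e^{-β𝓗})`).
[cite: Lieb1989, proof of Theorem 2] -/
theorem partitionFn_bdgBondHamiltonian_add_onSite (τ Δ : Λ → Λ → ℂ) (μ : ℝ) (U : ℂ) (β : ℝ) :
    partitionFn β (bdgBondHamiltonian τ Δ μ + U • ∑ x : Λ, numberOp x 0 * numberOp x 1) =
      Complex.exp (-(β : ℂ) * ∑ x : Λ, (τ x x - μ)) *
        partitionFn β (dGamma (bdgNambuMatrix τ Δ μ) +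
          U • ((∑ x : Λ, numberOp x 0) - ∑ x : Λ, numberOp x 0 * numberOp x 1)) := by
  have hW : partialParticleHole (spinDownOrbitals : Finset (Orb Λ)) ∈
      unitary (Matrix (Finset (Orb Λ)) (Finset (Orb Λ)) ℂ) :=
    partialParticleHole_mem_unitaryGroup _
  rw [← partitionFn_unitary_conj hW β (bdgBondHamiltonian τ Δ μ + U • _), star_eq_conjTranspose,
    partialParticleHole_conj_bdgBondHamiltonian_add_onSite, add_right_comm, partitionFn,
    gibbsWeight_add_smul_one, trace_smul, smul_eq_mul, partitionFn]

end General

/-! ### The `d`-wave–sourced Hubbard torus -/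

section Torus

variable (L : ℕ) [NeZero L]

/-- **The `d`-wave pair field is a BdG bond pairing**: for every `L ≥ 1`,
`Δ_d = pairField dWaveFormFactor L = bdgPairing Δ_L` with the bond amplitude
`Δ_L(u,v) = Σ_i √2·(±1)ᵢ [v = u + eᵢ]` (`+` for `e₀`, `-` for `e₁`; the factor `√2` collects the
normalisation `1/√2` of `localPair` and the two orientations of each bond,
`pairField_dWaveFormFactor_eq`). Scalapino, Phys. Rep. 250 (1995) 329, §2. [folklore] -/
theorem pairField_dWaveFormFactor_eq_bdgPairing :
    pairField dWaveFormFactor L =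
      bdgPairing (fun u v : FermionTorus 2 L => ∑ i : Fin 2,
        if v = FermionTorus.ofTorusSite (u.toTorusSite + Pi.single i 1) then
          ((Real.sqrt 2 * (if i = 0 then 1 else -1) : ℝ) : ℂ) else 0) := by
  rw [pairField_dWaveFormFactor_eq L, bdgPairing_eq]
  -- collapse the inner sum over `v`
  have hinner : ∀ u : FermionTorus 2 L,
      (∑ v : FermionTorus 2 L, (∑ i : Fin 2,
        if v = FermionTorus.ofTorusSite (u.toTorusSite + Pi.single i 1) then
          ((Real.sqrt 2 * (if i = 0 then 1 else -1) : ℝ) : ℂ) else 0) •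
        (annihilation (orb u 0) * annihilation (orb v 1) - annihilation (orb u 1) * annihilation (orb v 0))) =
      ∑ i : Fin 2, ((Real.sqrt 2 * (if i = 0 then 1 else -1) : ℝ) : ℂ) •
        (annihilation (orb u 0) *
            annihilation (orb (FermionTorus.ofTorusSite (u.toTorusSite + Pi.single i 1)) 1) -
          annihilation (orb u 1) *
            annihilation (orb (FermionTorus.ofTorusSite (u.toTorusSite + Pi.single i 1)) 0)) := by
    intro u
    simp only [Finset.sum_smul, ite_smul, zero_smul]
    rw [Finset.sum_comm]
    refine Finset.sum_congr rfl fun i _ => ?_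
    rw [Finset.sum_ite_eq' Finset.univ, if_pos (Finset.mem_univ _)]
  simp only [hinner]
  -- reindex the sites by the torus and recognise the directed-bond singlet pairs
  rw [FermionTorus.sum_eq_sum_torusSite]
  simp only [FermionTorus.toTorusSite_ofTorusSite, ← torusBondPair_eq]
  simp only [Fin.sum_univ_two, Fin.isValue, if_true, one_ne_zero, if_false, mul_one, mul_neg_one,
    Complex.ofReal_neg, neg_smul, Finset.sum_add_distrib, Finset.sum_neg_distrib, ← Finset.smul_sum,
    sub_eq_add_neg]
  rw [smul_add, smul_neg]

/-- **The sourced interacting torus is "BdG + on-site repulsion"** (every `L ≥ 1`):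
`dWaveSourceTorus L U μ h = H_BdG(τ_L, Δ_{L,h}, μ) + U Σ_x n_{x↑}n_{x↓}` with hopping
`τ_L(x,y) = -[x ∼ y]` (torus graph, `t = 1`) and bond pairing `Δ_{L,h}(u,v) = -h Σ_i √2(±1)ᵢ [v = u + eᵢ]`.
Koma–Tasaki 1994 §1 (the sourced Hamiltonian); `bdgBondHamiltonian_adj_zero`. [folklore] -/
theorem dWaveSourceTorus_eq_bdgBondHamiltonian_add (U μ h : ℝ) :
    dWaveSourceTorus L U μ h =
      bdgBondHamiltonian (fun x y => if (fermionTorusGraph 2 L).Adj x y then -(1 : ℂ) else 0)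
        (fun u v : FermionTorus 2 L => -(h : ℂ) * ∑ i : Fin 2,
          if v = FermionTorus.ofTorusSite (u.toTorusSite + Pi.single i 1) then
            ((Real.sqrt 2 * (if i = 0 then 1 else -1) : ℝ) : ℂ) else 0) μ +
        (U : ℂ) • ∑ x : FermionTorus 2 L, numberOp x 0 * numberOp x 1 := by
  have hpair : bdgPairing (fun u v : FermionTorus 2 L => -(h : ℂ) * ∑ i : Fin 2,
      if v = FermionTorus.ofTorusSite (u.toTorusSite + Pi.single i 1) then
        ((Real.sqrt 2 * (if i = 0 then 1 else -1) : ℝ) : ℂ) else 0) =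
      -(h : ℂ) • pairField dWaveFormFactor L := by
    rw [pairField_dWaveFormFactor_eq_bdgPairing, ← bdgPairing_smul]
    rfl
  have hfree : hubbardTorusWith 2 L 1 0 μ =
      bdgBondHamiltonian (fun x y => if (fermionTorusGraph 2 L).Adj x y then -(1 : ℂ) else 0) 0 μ := by
    rw [hubbardTorusWith, ← bdgBondHamiltonian_adj_zero, Complex.ofReal_one]
  have hsplit : dWaveSourceTorus L U μ h =
      dWaveSourceTorus L 0 μ h + (U : ℂ) • ∑ x : FermionTorus 2 L, numberOp x 0 * numberOp x 1 := by
    rw [dWaveSourceTorus, dWaveSourceTorus, hubbardTorusWith, hubbardTorusWith,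
      hamiltonianWith_eq_bdgBondHamiltonian_add, hamiltonianWith_eq_bdgBondHamiltonian_add,
      Complex.ofReal_zero, zero_smul, add_zero]
    abel
  rw [hsplit, dWaveSourceTorus, hfree, bdgBondHamiltonian_eq, bdgBondHamiltonian_eq, hpair]
  simp only [bdgPairing_zero, conjTranspose_zero, add_zero, neg_smul, conjTranspose_neg,
    conjTranspose_smul, Complex.star_def, Complex.conj_ofReal, smul_add, sub_eq_add_neg, neg_add]
  abel

/-- **Partial particle–hole transform of the interacting `d`-wave–sourced Hubbard torus**
(every `L ≥ 1`, all real `U, μ, h`):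
`W · dWaveSourceTorus L U μ h · Wᴴ = dΓ(𝓗_{L,μ,h}) - μL²·1 + U (N_↑ - Σ_x n_{x↑}n_{x↓})`,
`𝓗_{L,μ,h} = bdgNambuMatrix τ_L Δ_{L,h} μ` (blocks: `↑↑`: `-[x∼y] - μ`; `↓↓`: `+[x∼y] + μ`;
`↑↓/↓↑`: the `d`-wave source as a spin-flip bond hopping of strength `∝ h`). After Lieb's
transformation the `U(1)`-breaking pair source is an ordinary hopping term, the repulsion is an
attraction `-U Σ n↑n↓` plus `U N_↑`, and the whole Hamiltonian CONSERVES particle number — the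
setting of determinant perturbation theory. Lieb 1989 (proof of Thm 2); Shiba 1972 §2;
Micnas–Ranninger–Robaszkiewicz 1990 §II.B. [cite: Lieb1989, proof of Theorem 2] -/
theorem partialParticleHole_conj_dWaveSourceTorus (U μ h : ℝ) :
    partialParticleHole (spinDownOrbitals : Finset (Orb (FermionTorus 2 L))) *
        dWaveSourceTorus L U μ h *
        (partialParticleHole (spinDownOrbitals : Finset (Orb (FermionTorus 2 L))))ᴴ =
      dGamma (bdgNambuMatrix
          (fun x y => if (fermionTorusGraph 2 L).Adj x y then -(1 : ℂ) else 0)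
          (fun u v : FermionTorus 2 L => -(h : ℂ) * ∑ i : Fin 2,
            if v = FermionTorus.ofTorusSite (u.toTorusSite + Pi.single i 1) then
              ((Real.sqrt 2 * (if i = 0 then 1 else -1) : ℝ) : ℂ) else 0) μ) -
        ((μ : ℂ) * (L : ℂ) ^ 2) •
          (1 : Matrix (Finset (Orb (FermionTorus 2 L))) (Finset (Orb (FermionTorus 2 L))) ℂ) +
        (U : ℂ) • ((∑ x : FermionTorus 2 L, numberOp x 0) -
          ∑ x : FermionTorus 2 L, numberOp x 0 * numberOp x 1) := by
  have hcard : (Fintype.card (FermionTorus 2 L) : ℂ) = (L : ℂ) ^ 2 := by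
    simp [FermionTorus, Fintype.card_lex]
  have hdiag : (∑ x : FermionTorus 2 L,
      ((if (fermionTorusGraph 2 L).Adj x x then -(1 : ℂ) else 0) - μ)) = -((μ : ℂ) * (L : ℂ) ^ 2) := by
    simp only [SimpleGraph.irrefl, if_false, zero_sub, Finset.sum_neg_distrib, Finset.sum_const,
      Finset.card_univ, nsmul_eq_mul, hcard]
    ring
  have key := partialParticleHole_conj_bdgBondHamiltonian_add_onSite (Λ := FermionTorus 2 L)
    (fun x y => if (fermionTorusGraph 2 L).Adj x y then -(1 : ℂ) else 0)
    (fun u v : FermionTorus 2 L => -(h : ℂ) * ∑ i : Fin 2,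
      if v = FermionTorus.ofTorusSite (u.toTorusSite + Pi.single i 1) then
        ((Real.sqrt 2 * (if i = 0 then 1 else -1) : ℝ) : ℂ) else 0) μ (U : ℂ)
  rw [hdiag, neg_smul, ← sub_eq_add_neg] at key
  rw [dWaveSourceTorus_eq_bdgBondHamiltonian_add]
  -- the generic (`LinearOrder Λ`) and the concrete (`Lex`) `DecidableEq` paths to `1` meet here
  convert key using 9

/-- **The sourced partition function in number-conserving form**: for all real `β, U, μ, h` and
`L ≥ 1`,
`Tr e^{-β dWaveSourceTorus L U μ h} = e^{βμL²} · Tr e^{-β (dΓ(𝓗_{L,μ,h}) + U (N_↑ - Σ_x n_{x↑}n_{x↓}))}`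
(unitary invariance of the trace under `W` and `e^{-β(X - c·1)} = e^{βc} e^{-βX}`). At `U = 0`
the right-hand side is the determinant `det(1 + e^{-β𝓗})` (`partitionFn_dGamma_eq_det'`).
[cite: Lieb1989, proof of Theorem 2] -/
theorem partitionFn_dWaveSourceTorus_eq (β U μ h : ℝ) :
    partitionFn β (dWaveSourceTorus L U μ h) =
      (Real.exp (β * (μ * (L : ℝ) ^ 2)) : ℂ) *
        partitionFn β
          (dGamma (bdgNambuMatrix
              (fun x y => if (fermionTorusGraph 2 L).Adj x y then -(1 : ℂ) else 0)
              (fun u v : FermionTorus 2 L => -(h : ℂ) * ∑ i : Fin 2,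
                if v = FermionTorus.ofTorusSite (u.toTorusSite + Pi.single i 1) then
                  ((Real.sqrt 2 * (if i = 0 then 1 else -1) : ℝ) : ℂ) else 0) μ) +
            (U : ℂ) • ((∑ x : FermionTorus 2 L, numberOp x 0) -
              ∑ x : FermionTorus 2 L, numberOp x 0 * numberOp x 1)) := by
  have hcard : (Fintype.card (FermionTorus 2 L) : ℂ) = (L : ℂ) ^ 2 := by
    simp [FermionTorus, Fintype.card_lex]
  have hdiag : (∑ x : FermionTorus 2 L,
      ((if (fermionTorusGraph 2 L).Adj x x then -(1 : ℂ) else 0) - μ)) = -((μ : ℂ) * (L : ℂ) ^ 2) := by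
    simp only [SimpleGraph.irrefl, if_false, zero_sub, Finset.sum_neg_distrib, Finset.sum_const,
      Finset.card_univ, nsmul_eq_mul, hcard]
    ring
  have key := partitionFn_bdgBondHamiltonian_add_onSite (Λ := FermionTorus 2 L)
    (fun x y => if (fermionTorusGraph 2 L).Adj x y then -(1 : ℂ) else 0)
    (fun u v : FermionTorus 2 L => -(h : ℂ) * ∑ i : Fin 2,
      if v = FermionTorus.ofTorusSite (u.toTorusSite + Pi.single i 1) then
        ((Real.sqrt 2 * (if i = 0 then 1 else -1) : ℝ) : ℂ) else 0) μ (U : ℂ) β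
  rw [hdiag, show -(β : ℂ) * -((μ : ℂ) * (L : ℂ) ^ 2) = ((β * (μ * (L : ℝ) ^ 2) : ℝ) : ℂ) by
      push_cast; ring, ← Complex.ofReal_exp] at key
  rw [dWaveSourceTorus_eq_bdgBondHamiltonian_add]
  -- the generic (`LinearOrder Λ`) and the concrete (`Lex`) `DecidableEq` paths meet here
  convert key using 3

end Torus

end Literature.MathematicalPhysics.QuantumLattice

end
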